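import Summits.ValiantsHypothesis.ValiantsHypothesis.Theses.FermionizationDimension
import Summits.ValiantsHypothesis.ValiantsHypothesis.Theorems.TwistedDetRankTdrPerNotQPStubConePowerRankThree

/-!
# Route FermionizationDimension — crux `SDimPerNotQP` (stmt-ValiantsHypothesis-7286):
# the EXPONENTIAL lower bound on the commutative twisting dimension

Registered stub `stub_expLowerBound` of the line `registered` of the crux `SDimPerNotQP`.

**Theorem.** If a commutative finite-dimensional `ℂ`-algebra `R`, twists `u : Fin (3m) → Fin (3m) → R`
and a functional `ℓ : R →ₗ[ℂ] ℂ` realise the sign character of `𝔖_{3m}`,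
`ℓ (∏ i, u (σ i) i) = sgn σ`, then `3^m ≤ 2^m · finrank ℂ R`.  So `s(n) ≥ (3/2)^{⌊n/3⌋}`: the
commutative twisting ("fermionization") dimension of the permanent grows exponentially, which is
the crux `SDimPerNotQP` with room to spare (composition in
`Theorems/FermionizationDimensionSDimPerNotQP.lean`).

**Proof — the determinantal flattening of the Birkhoff cubic, on `R`-points.**
Restrict the realisation to block permutations `π ∈ 𝔖_3^m`: with the diagonal blocks
`ub_b ∈ R^{3×3}` and the `R`-valued cone coordinates `U_b(τ) = ∏_i ub_b (τ i) i` one has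
`ℓ (∏_b U_b(π_b)) = ∏_b sgn π_b`.  Flatten each block by the `3 × 3` linear determinantal
representation of the Birkhoff cubic (`TwistedDetRank`, stub `conePowerRankThree`):
`T(U) = [[U_id, -U_(01), 0], [0, U_(012), U_(02)], [U_(12), 0, U_(021)]] ∈ R^{3×3}`.  Pushing the
Kronecker power `⊗_R T(U_b)` (a `3^m × 3^m` matrix over `R`) through `ℓ` gives exactly
`L(sgn)^{⊗m}`, which is invertible (`det L(sgn) = 2`).  On the other hand, writing
`ub = [[a,b,c],[d,e,f],[g,h,k]]`, `T(U) = diag(k,c,f) · V · diag(a,d,g)` with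
`V = [[e,-b,0],[0,h,e],[h,0,b]]`, whose columns satisfy `b·c₁ + e·c₂ = h·c₃`; so if `h = ub 2 1`
is a UNIT of `R` then `T(U) = P · Q` factors through `R²`
(`P = [[ke,-kb],[0,ch],[fh,0]]`, `Q = [[a,0,gh⁻¹b],[0,d,gh⁻¹e]]`), hence
`⊗ T(U_b) = (⊗ P_b)(⊗ Q_b)` factors through `R^{2^m}` and
`ℓ_*(⊗ T(U_b)) = ∑_{γ ∈ [2]^m} (ℓ (P_{αγ} Q_{γβ}))_{α,β}`, each summand of rank `≤ finrank R`
(it factors through `R`): rank `≤ 2^m · finrank R`, so its determinant vanishes once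
`2^m · finrank R < 3^m`.  For general (possibly nilpotent) `h_b` perturb `h_b ↦ h_b + t`:
`t ↦ det ℓ_*(⊗ T(U_b^t))` is a polynomial in `t` (built over `R[X]`), it vanishes whenever all
`h_b + t` are units, i.e. for all `t` outside the finite set `{-χ_M(h_b)}` (`χ_M` the characters of
the finitely many maximal ideals), hence identically — contradicting `det L(sgn)^{⊗m} ≠ 0` at `t = 0`.

Sources: the flattening and the reduced case are the tree's proof of `TwistedDetRank.TdrPerNotQP`
(stmt-ValiantsHypothesis-6284, MarcusMinc1961 for the cubic); the extension to arbitrary commutative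
coefficient algebras is new here.
-/

set_option linter.dupNamespace false

namespace Summit.ValiantsHypothesis.ValiantsHypothesis.Theorems

namespace FermionizationDimensionSDimPerNotQPExpLowerBound

open Matrix Finset Polynomial
open Summit.ValiantsHypothesis.ValiantsHypothesis.Theorems.TwistedDetRankTdrPerNotQP

/-! Throughout, the flattening of a cone point `U` is `T(U)[a,c] = ε a c • U (ϖ a c)` with the sign
pattern `ε = ![![1, -1, 0], ![0, 1, 1], ![1, 0, 1]]` and the permutation pattern
`ϖ = ![![1, (0 1), 1], ![1, (0 1 2), (0 2)], ![(1 2), 1, (0 2 1)]]`, written out in full at each use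
(no notation or definition is introduced). -/

variable {R : Type} [CommRing R]

/-! ## Kronecker powers over a commutative ring -/

/-- Mixed-product rule for Kronecker powers indexed by functions, over a commutative ring:
`(⊗_j A_j) (⊗_j B_j) = ⊗_j (A_j B_j)`. [folklore] -/
theorem kron_mul {ι : Type*} [Fintype ι] [DecidableEq ι] {α β γ : ι → Type*}
    [∀ j, Fintype (β j)] (A : ∀ j, Matrix (α j) (β j) R) (B : ∀ j, Matrix (β j) (γ j) R) :
    (Matrix.of fun (a : ∀ j, α j) (e : ∀ j, β j) => ∏ j, A j (a j) (e j)) *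
        (Matrix.of fun (e : ∀ j, β j) (c : ∀ j, γ j) => ∏ j, B j (e j) (c j)) =
      Matrix.of fun (a : ∀ j, α j) (c : ∀ j, γ j) => ∏ j, (A j * B j) (a j) (c j) := by
  ext a c
  simp only [Matrix.mul_apply, Matrix.of_apply]
  rw [Fintype.prod_sum]
  exact Finset.sum_congr rfl fun e _ => (Finset.prod_mul_distrib).symm

/-- The product over `Fin (m·3)` along a block permutation splits into the blocks. [folklore] -/
theorem prod_blockPerm {m : ℕ} (u : Fin (m * 3) → Fin (m * 3) → R)
    (π : Fin m → Equiv.Perm (Fin 3)) :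
    ∏ i, u ((finProdFinEquiv.permCongr (Equiv.prodCongrRight π)) i) i =
      ∏ b, ∏ i, u (finProdFinEquiv (b, π b i)) (finProdFinEquiv (b, i)) := by
  rw [← finProdFinEquiv.prod_comp, Fintype.prod_prod_type]
  simp only [Equiv.permCongr_apply, Equiv.symm_apply_apply, Equiv.prodCongrRight_apply]

variable [Algebra ℂ R]

/-! ## Pushing bilinear data through a functional: rank at most `finrank R` -/

/-- The matrix `(x, y) ↦ ℓ (p x · q y)` factors through `R`, so its rank is at most `finrank ℂ R`.
[folklore] -/
theorem rank_bilinear_le [Module.Finite ℂ R] {X Y : Type*} [Fintype X] [Fintype Y]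
    [DecidableEq Y] (ℓ : R →ₗ[ℂ] ℂ) (p : X → R) (q : Y → R) :
    (Matrix.of fun x y => ℓ (p x * q y)).rank ≤ Module.finrank ℂ R := by
  let ψ : (Y → ℂ) →ₗ[ℂ] R := Fintype.linearCombination ℂ q
  let φ : R →ₗ[ℂ] (X → ℂ) := LinearMap.pi fun x => ℓ ∘ₗ LinearMap.mulLeft ℂ (p x)
  have hfac : (Matrix.of fun x y => ℓ (p x * q y)).mulVecLin = φ ∘ₗ ψ := by
    apply LinearMap.ext
    intro v
    funext x
    simp only [Matrix.mulVecLin_apply, Matrix.mulVec, dotProduct, Matrix.of_apply,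
      LinearMap.coe_comp, Function.comp_apply, LinearMap.pi_apply, LinearMap.mulLeft_apply, φ, ψ,
      Fintype.linearCombination_apply, map_sum, map_smul, smul_eq_mul]
    exact Finset.sum_congr rfl fun y _ => mul_comm _ _
  unfold Matrix.rank
  rw [hfac]
  calc Module.finrank ℂ (LinearMap.range (φ ∘ₗ ψ))
      ≤ Module.finrank ℂ (LinearMap.range φ) :=
        Submodule.finrank_mono (LinearMap.range_comp_le_range ψ φ)
    _ ≤ Module.finrank ℂ R := LinearMap.finrank_range_le φ

/-- If every factor factors through `R²`, the `ℓ`-pushforward of the Kronecker power has rank at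
most `2^m · finrank ℂ R` (it is a sum over `γ ∈ [2]^m` of matrices factoring through `R`).
[folklore] -/
theorem rank_push_kron_le [Module.Finite ℂ R] {m : ℕ} (ℓ : R →ₗ[ℂ] ℂ)
    (P : Fin m → Matrix (Fin 3) (Fin 2) R) (Q : Fin m → Matrix (Fin 2) (Fin 3) R) :
    (Matrix.of fun (a c : Fin m → Fin 3) => ℓ (∏ j, (P j * Q j) (a j) (c j))).rank ≤
      2 ^ m * Module.finrank ℂ R := by
  have hsum : (Matrix.of fun (a c : Fin m → Fin 3) => ℓ (∏ j, (P j * Q j) (a j) (c j))) =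
      ∑ γ : Fin m → Fin 2, Matrix.of fun (a c : Fin m → Fin 3) =>
        ℓ ((∏ j, P j (a j) (γ j)) * ∏ j, Q j (γ j) (c j)) := by
    ext a c
    have h := congrFun (congrFun (kron_mul P Q) a) c
    simp only [Matrix.mul_apply, Matrix.of_apply] at h
    have h' : ∏ j, (P j * Q j) (a j) (c j) =
        ∑ γ : Fin m → Fin 2, (∏ j, P j (a j) (γ j)) * ∏ j, Q j (γ j) (c j) := by
      rw [h]
      exact Finset.prod_congr rfl fun j _ => Matrix.mul_apply
    simp only [Matrix.of_apply, Matrix.sum_apply, h', map_sum]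
  rw [hsum]
  refine (conePowerRankThree_rank_sum_le _ _).trans ?_
  calc ∑ γ : Fin m → Fin 2, (Matrix.of fun (a c : Fin m → Fin 3) =>
          ℓ ((∏ j, P j (a j) (γ j)) * ∏ j, Q j (γ j) (c j))).rank
      ≤ ∑ _γ : Fin m → Fin 2, Module.finrank ℂ R :=
        Finset.sum_le_sum fun γ _ =>
          rank_bilinear_le ℓ (fun a : Fin m → Fin 3 => ∏ j, P j (a j) (γ j))
            (fun c : Fin m → Fin 3 => ∏ j, Q j (γ j) (c j))
    _ = 2 ^ m * Module.finrank ℂ R := by simp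

/-! ## The flattening of an `R`-valued cone point and its factorisation through `R²` -/

/-- Values of `finRotate 3` and its inverse. -/
theorem finRotate_vals :
    (finRotate 3 : Equiv.Perm (Fin 3)) 0 = 1 ∧ (finRotate 3 : Equiv.Perm (Fin 3)) 1 = 2 ∧
    (finRotate 3 : Equiv.Perm (Fin 3)) 2 = 0 ∧ ((finRotate 3)⁻¹ : Equiv.Perm (Fin 3)) 0 = 2 ∧
    ((finRotate 3)⁻¹ : Equiv.Perm (Fin 3)) 1 = 0 ∧ ((finRotate 3)⁻¹ : Equiv.Perm (Fin 3)) 2 = 1 := by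
  decide

/-- **Factorisation through `R²`.** If the entry `ub 2 1` is a unit, the flattening
`T(U)[a,c] = ε a c • ∏ i, ub (ϖ a c i) i` of the `R`-valued cone point of `ub` is a product
`P · Q` with `P ∈ R^{3×2}`, `Q ∈ R^{2×3}`. [new; elementary] -/
theorem exists_factor_of_isUnit (ub : Matrix (Fin 3) (Fin 3) R) (hu : IsUnit (ub 2 1)) :
    ∃ (P : Matrix (Fin 3) (Fin 2) R) (Q : Matrix (Fin 2) (Fin 3) R),
      P * Q = Matrix.of fun a c => (![![(1 : ℂ), -1, 0], ![0, 1, 1], ![1, 0, 1]] : Fin 3 → Fin 3 → ℂ) a c • ∏ i, ub ((![![(1 : Equiv.Perm (Fin 3)), Equiv.swap 0 1, 1], ![1, finRotate 3, Equiv.swap 0 2], ![Equiv.swap 1 2, 1, (finRotate 3)⁻¹]] : Fin 3 → Fin 3 → Equiv.Perm (Fin 3)) a c i) i := by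
  obtain ⟨w, hw⟩ := hu.exists_right_inv
  obtain ⟨h1, h2, h3, h4, h5, h6⟩ := finRotate_vals
  refine ⟨!![ub 2 2 * ub 1 1, -(ub 2 2 * ub 0 1); 0, ub 0 2 * ub 2 1; ub 1 2 * ub 2 1, 0],
    !![ub 0 0, 0, ub 2 0 * w * ub 0 1; 0, ub 1 0, ub 2 0 * w * ub 1 1], ?_⟩
  ext a c
  fin_cases a <;> fin_cases c <;>
    simp [Matrix.mul_apply, Fin.sum_univ_two, Fin.prod_univ_three, h1, h2, h3, h4, h5, h6,
      Equiv.swap_apply_of_ne_of_ne]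
  · ring
  · ring
  · ring
  · ring
  · linear_combination (ub 0 2 * ub 2 0 * ub 1 1) * hw
  · ring
  · linear_combination (ub 1 2 * ub 2 0 * ub 0 1) * hw

/-- **Unit case.** If all the entries `ub j 2 1` are units and `2^m · finrank R < 3^m`, the
`ℓ`-pushforward of the Kronecker power of the flattenings is singular. [new] -/
theorem det_push_kron_eq_zero_of_isUnit [Module.Finite ℂ R] {m : ℕ} (ℓ : R →ₗ[ℂ] ℂ)
    (ub : Fin m → Matrix (Fin 3) (Fin 3) R) (hu : ∀ j, IsUnit (ub j 2 1))
    (hd : 2 ^ m * Module.finrank ℂ R < 3 ^ m) :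
    (Matrix.of fun (a c : Fin m → Fin 3) =>
      ℓ (∏ j, (Matrix.of fun a' c' => (![![(1 : ℂ), -1, 0], ![0, 1, 1], ![1, 0, 1]] : Fin 3 → Fin 3 → ℂ) a' c' • ∏ i, ub j ((![![(1 : Equiv.Perm (Fin 3)), Equiv.swap 0 1, 1], ![1, finRotate 3, Equiv.swap 0 2], ![Equiv.swap 1 2, 1, (finRotate 3)⁻¹]] : Fin 3 → Fin 3 → Equiv.Perm (Fin 3)) a' c' i) i) (a j) (c j))).det =
      0 := by
  choose P Q hPQ using fun j => exists_factor_of_isUnit (ub j) (hu j)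
  simp_rw [← hPQ]
  by_contra hne
  have hunit : IsUnit (Matrix.of fun (a c : Fin m → Fin 3) => ℓ (∏ j, (P j * Q j) (a j) (c j))) :=
    (Matrix.isUnit_iff_isUnit_det _).2 (isUnit_iff_ne_zero.2 hne)
  have hrank := Matrix.rank_of_isUnit _ hunit
  have hle := rank_push_kron_le ℓ P Q
  rw [hrank] at hle
  simp only [Fintype.card_fun, Fintype.card_fin] at hle
  omega

/-! ## Characters and the finiteness of the bad perturbation parameters -/

/-- Every maximal ideal of a finite-dimensional commutative `ℂ`-algebra is the kernel of a character
(its residue field, finite over the algebraically closed `ℂ`, is `ℂ`). [folklore] -/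
theorem exists_char_maximal [Module.Finite ℂ R] (M : MaximalSpectrum R) :
    ∃ χ : R →ₐ[ℂ] ℂ, ∀ x ∈ M.asIdeal, χ x = 0 := by
  let ρ : (R ⧸ M.asIdeal) ≃ₐ[ℂ] ℂ :=
    (AlgEquiv.ofBijective (Algebra.ofId ℂ (R ⧸ M.asIdeal))
      IsAlgClosed.algebraMap_bijective_of_isIntegral).symm
  refine ⟨ρ.toAlgHom.comp (Ideal.Quotient.mkₐ ℂ M.asIdeal), fun x hx => ?_⟩
  have hx0 : Ideal.Quotient.mkₐ ℂ M.asIdeal x = 0 :=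
    (Ideal.Quotient.mkₐ_eq_mk ℂ M.asIdeal ▸ Ideal.Quotient.eq_zero_iff_mem.2 hx :)
  rw [AlgHom.comp_apply, hx0, map_zero]

/-- Off a finite set of parameters `t`, all the perturbed entries `h_j + t` are units: a non-unit lies
in a maximal ideal `M`, and then `t = -χ_M(h_j)`. [folklore] -/
theorem exists_finset_isUnit_add [Module.Finite ℂ R] {m : ℕ} (h : Fin m → R) :
    ∃ B : Finset ℂ, ∀ t ∉ B, ∀ j, IsUnit (h j + algebraMap ℂ R t) := by
  classical
  haveI : IsArtinianRing R := IsArtinianRing.of_finite ℂ R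
  letI : Fintype (MaximalSpectrum R) := Fintype.ofFinite _
  choose χ hχ using fun M : MaximalSpectrum R => exists_char_maximal M
  refine ⟨(Finset.univ : Finset (MaximalSpectrum R × Fin m)).image fun p => -χ p.1 (h p.2),
    fun t ht j => ?_⟩
  by_contra hnu
  obtain ⟨I, hI, hmem⟩ := exists_max_ideal_of_mem_nonunits (mem_nonunits_iff.2 hnu)
  apply ht
  rw [Finset.mem_image]
  refine ⟨(⟨I, hI⟩, j), Finset.mem_univ _, ?_⟩
  have h0 := hχ ⟨I, hI⟩ _ hmem
  rw [map_add, AlgHom.commutes, Algebra.algebraMap_self, RingHom.id_apply] at h0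
  show -χ ⟨I, hI⟩ (h j) = t
  linear_combination -h0

/-! ## The perturbation polynomial -/

/-- Pushing the coefficients of `p ∈ R[X]` through `ℓ` commutes with evaluation at scalars:
`(∑ₙ ℓ(pₙ) Xⁿ)(t) = ℓ (p (t·1))`. [folklore] -/
theorem eval_push (ℓ : R →ₗ[ℂ] ℂ) (p : R[X]) (t : ℂ) :
    (p.sum fun n a => Polynomial.monomial n (ℓ a)).eval t = ℓ (p.eval (algebraMap ℂ R t)) := by
  rw [Polynomial.eval_eq_sum (p := p), Polynomial.sum_def, Polynomial.sum_def,
    Polynomial.eval_finsetSum, map_sum]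
  refine Finset.sum_congr rfl fun n _ => ?_
  rw [Polynomial.eval_monomial, ← map_pow, ← Algebra.commutes, ← Algebra.smul_def, map_smul,
    smul_eq_mul, mul_comm]

/-- **The determinant of the pushed Kronecker power vanishes** once `2^m · finrank R < 3^m`, for
ARBITRARY blocks `ub` (units or not): perturb the `(2,1)` entries by `t`, get a polynomial in `t`
vanishing off a finite set, hence identically, hence at `t = 0`. [new] -/
theorem det_push_kron_eq_zero [Module.Finite ℂ R] {m : ℕ} (ℓ : R →ₗ[ℂ] ℂ)
    (ub : Fin m → Matrix (Fin 3) (Fin 3) R) (hd : 2 ^ m * Module.finrank ℂ R < 3 ^ m) :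
    (Matrix.of fun (a c : Fin m → Fin 3) =>
      ℓ (∏ j, (Matrix.of fun a' c' => (![![(1 : ℂ), -1, 0], ![0, 1, 1], ![1, 0, 1]] : Fin 3 → Fin 3 → ℂ) a' c' • ∏ i, ub j ((![![(1 : Equiv.Perm (Fin 3)), Equiv.swap 0 1, 1], ![1, finRotate 3, Equiv.swap 0 2], ![Equiv.swap 1 2, 1, (finRotate 3)⁻¹]] : Fin 3 → Fin 3 → Equiv.Perm (Fin 3)) a' c' i) i) (a j) (c j))).det =
      0 := by
  classical
  -- the perturbed blocks over `R[X]` and over `R` (parameter `t`)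
  let ubX : Fin m → Matrix (Fin 3) (Fin 3) R[X] := fun j i' i =>
    Polynomial.C (ub j i' i) + if i' = 2 ∧ i = 1 then Polynomial.X else 0
  let ubt : ℂ → Fin m → Matrix (Fin 3) (Fin 3) R := fun t j i' i =>
    ub j i' i + if i' = 2 ∧ i = 1 then algebraMap ℂ R t else 0
  -- the polynomial
  let PX : Matrix (Fin m → Fin 3) (Fin m → Fin 3) ℂ[X] := Matrix.of fun a c =>
    (∏ j, (Matrix.of fun a' c' => (![![(1 : ℂ), -1, 0], ![0, 1, 1], ![1, 0, 1]] : Fin 3 → Fin 3 → ℂ) a' c' • ∏ i, ubX j ((![![(1 : Equiv.Perm (Fin 3)), Equiv.swap 0 1, 1], ![1, finRotate 3, Equiv.swap 0 2], ![Equiv.swap 1 2, 1, (finRotate 3)⁻¹]] : Fin 3 → Fin 3 → Equiv.Perm (Fin 3)) a' c' i) i) (a j) (c j)).sum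
      fun n r => Polynomial.monomial n (ℓ r)
  -- its values
  have heval : ∀ t : ℂ, PX.det.eval t =
      (Matrix.of fun (a c : Fin m → Fin 3) =>
        ℓ (∏ j, (Matrix.of fun a' c' => (![![(1 : ℂ), -1, 0], ![0, 1, 1], ![1, 0, 1]] : Fin 3 → Fin 3 → ℂ) a' c' • ∏ i, ubt t j ((![![(1 : Equiv.Perm (Fin 3)), Equiv.swap 0 1, 1], ![1, finRotate 3, Equiv.swap 0 2], ![Equiv.swap 1 2, 1, (finRotate 3)⁻¹]] : Fin 3 → Fin 3 → Equiv.Perm (Fin 3)) a' c' i) i)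
          (a j) (c j))).det := by
    intro t
    rw [← Polynomial.coe_evalRingHom, RingHom.map_det]
    congr 1
    ext a c
    simp only [RingHom.mapMatrix_apply, Matrix.map_apply, Matrix.of_apply,
      Polynomial.coe_evalRingHom, PX]
    rw [eval_push, Polynomial.eval_prod]
    congr 1
    refine Finset.prod_congr rfl fun j _ => ?_
    rw [Polynomial.eval_smul, Polynomial.eval_prod]
    congr 1
    refine Finset.prod_congr rfl fun i _ => ?_
    simp only [ubX, ubt, Polynomial.eval_add, Polynomial.eval_C]
    split_ifs <;> simp
  -- it vanishes off a finite set
  obtain ⟨B, hB⟩ := exists_finset_isUnit_add (R := R) fun j => ub j 2 1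
  have hroot : ∀ t ∉ B, PX.det.IsRoot t := by
    intro t ht
    rw [Polynomial.IsRoot, heval t]
    refine det_push_kron_eq_zero_of_isUnit ℓ (ubt t) (fun j => ?_) hd
    simpa [ubt] using hB t ht j
  -- hence identically
  have hzero : PX.det = 0 := by
    apply Polynomial.eq_zero_of_infinite_isRoot
    refine Set.Infinite.mono (fun t ht => hroot t ht) ?_
    exact (B.finite_toSet).infinite_compl
  -- hence at `t = 0`
  have h0 := heval 0
  rw [hzero, Polynomial.eval_zero] at h0
  have hubt : ubt 0 = ub := by
    funext j i' i
    simp [ubt]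
  rw [hubt] at h0
  exact h0.symm

/-! ## Block restriction of a realisation and the flattening of the sign character -/

/-- The flattening of the sign character of `𝔖_3`, `S[a,c] = ε a c · sgn (ϖ a c)`, is
`[[1,1,0],[0,1,-1],[-1,0,1]]`, with `S · adj(S) = 2`; so its Kronecker powers are invertible.
[TwistedDetRank, stub conePowerRankThree] -/
theorem flatSign_mul_inv :
    (Matrix.of fun a c => (![![(1 : ℂ), -1, 0], ![0, 1, 1], ![1, 0, 1]] : Fin 3 → Fin 3 → ℂ) a c * (((Equiv.Perm.sign ((![![(1 : Equiv.Perm (Fin 3)), Equiv.swap 0 1, 1], ![1, finRotate 3, Equiv.swap 0 2], ![Equiv.swap 1 2, 1, (finRotate 3)⁻¹]] : Fin 3 → Fin 3 → Equiv.Perm (Fin 3)) a c)) : ℤ) : ℂ)) *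
      ((1 / 2 : ℂ) • !![1, -1, -1; 1, 1, 1; 1, -1, 1]) = 1 := by
  obtain ⟨h1, h2, h3, h4, h5, h6⟩ := finRotate_vals
  have hr : Equiv.Perm.sign (finRotate 3 : Equiv.Perm (Fin 3)) = 1 := by decide
  have hr' : Equiv.Perm.sign ((finRotate 3)⁻¹ : Equiv.Perm (Fin 3)) = 1 := by decide
  have hs1 : Equiv.Perm.sign (Equiv.swap (0 : Fin 3) 1) = -1 := by decide
  have hs2 : Equiv.Perm.sign (Equiv.swap (0 : Fin 3) 2) = -1 := by decide
  have hs3 : Equiv.Perm.sign (Equiv.swap (1 : Fin 3) 2) = -1 := by decide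
  ext a c
  fin_cases a <;> fin_cases c <;>
    simp [Matrix.mul_apply, Fin.sum_univ_three, hr, hr', hs1, hs2, hs3] <;> norm_num

/-- **The pushed Kronecker power of the block flattenings of a realisation is `L(sgn)^{⊗m}`.**
[new; the computation behind the flattening method on `R`-points] -/
theorem push_kron_eq_flatSign {m : ℕ} (ℓ : R →ₗ[ℂ] ℂ) (ub : Fin m → Matrix (Fin 3) (Fin 3) R)
    (hub : ∀ π : Fin m → Equiv.Perm (Fin 3),
      ℓ (∏ b, ∏ i, ub b (π b i) i) = ∏ b, ((Equiv.Perm.sign (π b) : ℤ) : ℂ)) :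
    (Matrix.of fun (a c : Fin m → Fin 3) =>
      ℓ (∏ j, (Matrix.of fun a' c' => (![![(1 : ℂ), -1, 0], ![0, 1, 1], ![1, 0, 1]] : Fin 3 → Fin 3 → ℂ) a' c' • ∏ i, ub j ((![![(1 : Equiv.Perm (Fin 3)), Equiv.swap 0 1, 1], ![1, finRotate 3, Equiv.swap 0 2], ![Equiv.swap 1 2, 1, (finRotate 3)⁻¹]] : Fin 3 → Fin 3 → Equiv.Perm (Fin 3)) a' c' i) i) (a j) (c j))) =
      Matrix.of fun (a c : Fin m → Fin 3) =>
        ∏ j, (Matrix.of fun a' c' => (![![(1 : ℂ), -1, 0], ![0, 1, 1], ![1, 0, 1]] : Fin 3 → Fin 3 → ℂ) a' c' * (((Equiv.Perm.sign ((![![(1 : Equiv.Perm (Fin 3)), Equiv.swap 0 1, 1], ![1, finRotate 3, Equiv.swap 0 2], ![Equiv.swap 1 2, 1, (finRotate 3)⁻¹]] : Fin 3 → Fin 3 → Equiv.Perm (Fin 3)) a' c')) : ℤ) : ℂ))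
          (a j) (c j) := by
  ext a c
  simp only [Matrix.of_apply]
  have hsmul : ∏ j, ((![![(1 : ℂ), -1, 0], ![0, 1, 1], ![1, 0, 1]] : Fin 3 → Fin 3 → ℂ) (a j) (c j) • ∏ i, ub j ((![![(1 : Equiv.Perm (Fin 3)), Equiv.swap 0 1, 1], ![1, finRotate 3, Equiv.swap 0 2], ![Equiv.swap 1 2, 1, (finRotate 3)⁻¹]] : Fin 3 → Fin 3 → Equiv.Perm (Fin 3)) (a j) (c j) i) i) =
      (∏ j, (![![(1 : ℂ), -1, 0], ![0, 1, 1], ![1, 0, 1]] : Fin 3 → Fin 3 → ℂ) (a j) (c j)) • ∏ j, ∏ i, ub j ((![![(1 : Equiv.Perm (Fin 3)), Equiv.swap 0 1, 1], ![1, finRotate 3, Equiv.swap 0 2], ![Equiv.swap 1 2, 1, (finRotate 3)⁻¹]] : Fin 3 → Fin 3 → Equiv.Perm (Fin 3)) (a j) (c j) i) i := by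
    simp only [Algebra.smul_def, Finset.prod_mul_distrib, map_prod]
  rw [hsmul, map_smul, hub (fun j => (![![(1 : Equiv.Perm (Fin 3)), Equiv.swap 0 1, 1], ![1, finRotate 3, Equiv.swap 0 2], ![Equiv.swap 1 2, 1, (finRotate 3)⁻¹]] : Fin 3 → Fin 3 → Equiv.Perm (Fin 3)) (a j) (c j)), smul_eq_mul, ← Finset.prod_mul_distrib]

/-- Kronecker powers of the flattening of the sign character are invertible: determinant nonzero.
[TwistedDetRank, stub conePowerRankThree] -/
theorem det_kron_flatSign_ne_zero (m : ℕ) :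
    (Matrix.of fun (a c : Fin m → Fin 3) =>
      ∏ j, (Matrix.of fun a' c' => (![![(1 : ℂ), -1, 0], ![0, 1, 1], ![1, 0, 1]] : Fin 3 → Fin 3 → ℂ) a' c' * (((Equiv.Perm.sign ((![![(1 : Equiv.Perm (Fin 3)), Equiv.swap 0 1, 1], ![1, finRotate 3, Equiv.swap 0 2], ![Equiv.swap 1 2, 1, (finRotate 3)⁻¹]] : Fin 3 → Fin 3 → Equiv.Perm (Fin 3)) a' c')) : ℤ) : ℂ))
        (a j) (c j)).det ≠ 0 := by
  have hmul := kron_mul (R := ℂ)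
    (fun _ : Fin m => Matrix.of fun a' c' => (![![(1 : ℂ), -1, 0], ![0, 1, 1], ![1, 0, 1]] : Fin 3 → Fin 3 → ℂ) a' c' * (((Equiv.Perm.sign ((![![(1 : Equiv.Perm (Fin 3)), Equiv.swap 0 1, 1], ![1, finRotate 3, Equiv.swap 0 2], ![Equiv.swap 1 2, 1, (finRotate 3)⁻¹]] : Fin 3 → Fin 3 → Equiv.Perm (Fin 3)) a' c')) : ℤ) : ℂ))
    (fun _ : Fin m => (1 / 2 : ℂ) • !![1, -1, -1; 1, 1, 1; 1, -1, 1])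
  simp_rw [flatSign_mul_inv] at hmul
  rw [conePowerRankThree_kron_one] at hmul
  intro h0
  have := congrArg Matrix.det hmul
  rw [Matrix.det_mul, h0, zero_mul, Matrix.det_one] at this
  exact zero_ne_one this

end FermionizationDimensionSDimPerNotQPExpLowerBound

open FermionizationDimensionSDimPerNotQPExpLowerBound in
/-- **Exponential lower bound on the commutative twisting dimension** (registered stub
`stub_expLowerBound` of the line `registered` of crux `SDimPerNotQP`, stmt-ValiantsHypothesis-7286).
Every commutative realisation `(R, u, ℓ)` of `sgn_{3m}` over a finite-dimensional commutative
`ℂ`-algebra `R` has `3^m ≤ 2^m · finrank ℂ R`, i.e. `s(3m) ≥ (3/2)^m`.  Proof: block restriction,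
the determinantal flattening of the Birkhoff cubic on `R`-points, factorisation through `R²` for unit
entries, polynomial perturbation for the rest. [new] -/
theorem stub_expLowerBound :
    ∀ (m : ℕ) (R : Type) [CommRing R] [Algebra ℂ R] [Module.Finite ℂ R] (u : Fin (m * 3) → Fin (m * 3) → R) (ℓ : R →ₗ[ℂ] ℂ), (∀ σ : Equiv.Perm (Fin (m * 3)), ℓ (∏ i, u (σ i) i) = ((Equiv.Perm.sign σ : ℤ) : ℂ)) → 3 ^ m ≤ 2 ^ m * Module.finrank ℂ R := by
  intro m R _ _ _ u ℓ hu
  -- the diagonal blocks and the restricted identity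
  let ub : Fin m → Matrix (Fin 3) (Fin 3) R := fun b i' i =>
    u (finProdFinEquiv (b, i')) (finProdFinEquiv (b, i))
  have hub : ∀ π : Fin m → Equiv.Perm (Fin 3),
      ℓ (∏ b, ∏ i, ub b (π b i) i) = ∏ b, ((Equiv.Perm.sign (π b) : ℤ) : ℂ) := by
    intro π
    have h := hu (finProdFinEquiv.permCongr (Equiv.prodCongrRight π))
    rw [prod_blockPerm u π, Equiv.Perm.sign_permCongr, Equiv.Perm.sign_prodCongrRight,
      Units.coe_prod, Int.cast_prod] at h
    exact h
  by_contra hlt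
  have hd : 2 ^ m * Module.finrank ℂ R < 3 ^ m := Nat.lt_of_not_le hlt
  have h0 := det_push_kron_eq_zero ℓ ub hd
  rw [push_kron_eq_flatSign ℓ ub hub] at h0
  exact det_kron_flatSign_ne_zero m h0

end Summit.ValiantsHypothesis.ValiantsHypothesis.Theorems
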